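import Summits.AtomisticToContinuum.BoseEinsteinCondensation.Theorems.BECInsertionCorrectorStaticResponseBoundInfraredWindow
import Literature.MathematicalPhysics.QuantumManyBody.PeriodicBoseGasUpperBoundProofs
import HarnessLib

/-!
# The few-body window of crux `BECInsertionCorrector.StaticResponseBound`
# (stmt-AtomisticToContinuum-12057, line `stable-fraction-square-completion`, seat c2 layer): stub `stub_fewBodyWindow`

At side length `L = (N/ρ)^{1/3}` and scattering length `a = (scatteringLength v).toReal`, the window
`N⁸ · ρa³ ≤ c(v)` forces, for every admissible `v`, all small `ρ` and all `N ≥ 1`,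

* the FEW-BODY regime `N · E₀^per(v,N,L) · L² ≤ 4π²/5`: for `N ≥ 2` the Dyson–LSSY periodic upper
  bound `E₀^per ≤ 4πρ₁a(1 + C a/b)N ≤ K ρ a N` ([LSSY2005, Thm. 2.2 (2.14)], proved in the tree as
  `LSSY2005_upperBound_periodic_holds`; `ρ₁ = (N-1)/L³ ≤ ρ`, `a/b = a(4πρ₁/3)^{1/3} ≤ c₁` for small `ρ`)
  gives `(N·E₀·L²)³ ≤ K³ρ³a³N⁶L⁶ = K³·N⁸ρa³ ≤ K³c ≤ (4π²/5)³`; for `N = 1`, `E₀ = 0`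
  (`periodicGroundStateEnergy_one`);
* the ULTRAVIOLET branch `ρa ≤ |p|²` for every `k ≠ 0`: `(ρaL²)³ = ρa³N² ≤ N⁸ρa³ ≤ c ≤ (4π²)³`, so
  `ρa ≤ (2π/L)² ≤ |p|²` (`sq_div_le_psq`).

All estimates are cubed, so no fractional powers beyond `L³ = N/ρ` (`sideLength_pow_three`) and
`b⁻¹ = (4πρ₁/3)^{1/3}` enter.  The case `a = 0` is covered by the same inequalities.
-/

noncomputable section

namespace Summit.AtomisticToContinuum.BoseEinsteinCondensation.Cruxes.StaticResponseBound.FewBody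

open MeasureTheory Filter
open scoped ENNReal NNReal BigOperators
open Literature.MathematicalPhysics.QuantumManyBody.BoseGas
open Summit.AtomisticToContinuum.BoseEinsteinCondensation.Theses
open Summit.AtomisticToContinuum.BoseEinsteinCondensation.Theses.BECInsertionCorrector
open Summit.AtomisticToContinuum.BoseEinsteinCondensation.Theorems.StaticResponseBound.Negative
open Summit.AtomisticToContinuum.BoseEinsteinCondensation.Cruxes.StaticResponseBound.UvThomsonForceWave

/-! ## Real arithmetic of the window (everything cubed) -/

/-- The LSSY smallness parameter: if `0 ≤ ρₑ ≤ ρ ≤ 3c₁³/(4π(a³+1))` then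
`a / (4πρₑ/3)^{-1/3} = a (4πρₑ/3)^{1/3} ≤ c₁` (cube both sides). [folklore] -/
theorem ratio_le_of_density_le {a c₁ ρ ρe : ℝ} (ha : 0 ≤ a) (hc₁ : 0 < c₁) (hρe : 0 ≤ ρe)
    (hρeρ : ρe ≤ ρ) (hρ : ρ ≤ 3 * c₁ ^ 3 / (4 * Real.pi * (a ^ 3 + 1))) :
    a / (4 * Real.pi * ρe / 3) ^ (-(1 : ℝ) / 3) ≤ c₁ := by
  have hx : 0 ≤ 4 * Real.pi * ρe / 3 := by positivity
  rw [show (-(1 : ℝ) / 3) = -(1 / 3) by norm_num, Real.rpow_neg hx, div_inv_eq_mul]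
  set y := (4 * Real.pi * ρe / 3) ^ ((1 : ℝ) / 3) with hy
  have hy0 : 0 ≤ y := Real.rpow_nonneg hx _
  have hy3 : y ^ 3 = 4 * Real.pi * ρe / 3 := by
    rw [hy, show ((1 : ℝ) / 3) = ((3 : ℕ) : ℝ)⁻¹ by norm_num,
      Real.rpow_inv_natCast_pow hx three_ne_zero]
  refine le_of_pow_le_pow_left₀ three_ne_zero hc₁.le ?_
  have hρ0 : 0 ≤ ρ := hρe.trans hρeρ
  have ha3 : 0 ≤ a ^ 3 := by positivity
  have h1 : a ^ 3 * (4 * Real.pi * ρe / 3) ≤ (a ^ 3 + 1) * (4 * Real.pi * ρ / 3) := by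
    have h11 : a ^ 3 * (4 * Real.pi * ρe / 3) ≤ a ^ 3 * (4 * Real.pi * ρ / 3) := by gcongr
    have h12 : a ^ 3 * (4 * Real.pi * ρ / 3) ≤ (a ^ 3 + 1) * (4 * Real.pi * ρ / 3) :=
      mul_le_mul_of_nonneg_right (by linarith) (by positivity)
    exact h11.trans h12
  have h2 : (a ^ 3 + 1) * (4 * Real.pi * ρ / 3) ≤ c₁ ^ 3 := by
    have h21 := mul_le_mul_of_nonneg_left hρ
      (by positivity : (0 : ℝ) ≤ (a ^ 3 + 1) * (4 * Real.pi / 3))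
    calc (a ^ 3 + 1) * (4 * Real.pi * ρ / 3) = (a ^ 3 + 1) * (4 * Real.pi / 3) * ρ := by ring
      _ ≤ (a ^ 3 + 1) * (4 * Real.pi / 3) * (3 * c₁ ^ 3 / (4 * Real.pi * (a ^ 3 + 1))) := h21
      _ = c₁ ^ 3 := by field_simp
  calc (a * y) ^ 3 = a ^ 3 * y ^ 3 := by ring
    _ = a ^ 3 * (4 * Real.pi * ρe / 3) := by rw [hy3]
    _ ≤ c₁ ^ 3 := h1.trans h2

/-- The range condition: if `ρ < 1/(2R)³`, `R > 0`, `1 ≤ N` and `L³ = N/ρ`, `L > 0`, then `2R < L`. [folklore] -/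
theorem two_mul_lt_of_pow_three {R ρ L N : ℝ} (hR : 0 < R) (hρ : 0 < ρ) (hL : 0 < L) (hN : 1 ≤ N)
    (hL3 : L ^ 3 = N / ρ) (hρlt : ρ < 1 / (2 * R) ^ 3) : 2 * R < L := by
  refine lt_of_pow_lt_pow_left₀ 3 hL.le ?_
  rw [hL3, lt_div_iff₀ hρ]
  have h1 : ρ * (2 * R) ^ 3 < 1 := by
    have := mul_lt_mul_of_pos_right hρlt (by positivity : (0 : ℝ) < (2 * R) ^ 3)
    rwa [div_mul_cancel₀ _ (by positivity)] at this
  nlinarith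

/-- The few-body energy arithmetic: `N · (KρaN) · L² ≤ 4π²/5` once `L³ = N/ρ`,
`N⁸ρa³ ≤ c ≤ (4π²/(5K))³` (cube: `(KρaN²L²)³ = K³ N⁸ ρa³`). [folklore] -/
theorem energy_window_le {K ρ a c L N : ℝ} (hK : 0 < K) (hρ : 0 < ρ) (hL3 : L ^ 3 = N / ρ)
    (hwin : N ^ 8 * (ρ * a ^ 3) ≤ c) (hc : c ≤ (4 * Real.pi ^ 2 / (5 * K)) ^ 3) :
    N * (K * ρ * a * N) * L ^ 2 ≤ 4 * Real.pi ^ 2 / 5 := by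
  refine le_of_pow_le_pow_left₀ three_ne_zero (by positivity) ?_
  have hL6 : (L ^ 2) ^ 3 = (N / ρ) ^ 2 := by rw [← hL3]; ring
  have hX3 : (N * (K * ρ * a * N) * L ^ 2) ^ 3 = K ^ 3 * (N ^ 8 * (ρ * a ^ 3)) := by
    calc (N * (K * ρ * a * N) * L ^ 2) ^ 3 = K ^ 3 * ρ ^ 3 * a ^ 3 * N ^ 6 * (L ^ 2) ^ 3 := by ring
      _ = K ^ 3 * ρ ^ 3 * a ^ 3 * N ^ 6 * (N / ρ) ^ 2 := by rw [hL6]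
      _ = K ^ 3 * (N ^ 8 * (ρ * a ^ 3)) := by field_simp
  have hY3 : (4 * Real.pi ^ 2 / 5) ^ 3 = K ^ 3 * (4 * Real.pi ^ 2 / (5 * K)) ^ 3 := by
    field_simp
  rw [hX3, hY3]
  exact mul_le_mul_of_nonneg_left (hwin.trans hc) (by positivity)

/-- The ultraviolet-branch arithmetic: `ρa ≤ (2π/L)²` once `L³ = N/ρ`, `1 ≤ N`,
`N⁸ρa³ ≤ c ≤ (4π²)³` (cube: `(ρaL²)³ = ρa³N² ≤ N⁸ρa³`). [folklore] -/
theorem density_mul_le_sq_div {ρ a c L N : ℝ} (hρ : 0 < ρ) (ha : 0 ≤ a) (hN : 1 ≤ N) (hL : 0 < L)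
    (hL3 : L ^ 3 = N / ρ) (hwin : N ^ 8 * (ρ * a ^ 3) ≤ c) (hc : c ≤ (4 * Real.pi ^ 2) ^ 3) :
    ρ * a ≤ (2 * Real.pi / L) ^ 2 := by
  rw [div_pow, le_div_iff₀ (by positivity)]
  refine le_of_pow_le_pow_left₀ three_ne_zero (by positivity) ?_
  have hL6 : (L ^ 2) ^ 3 = (N / ρ) ^ 2 := by rw [← hL3]; ring
  have hX3 : (ρ * a * L ^ 2) ^ 3 = N ^ 2 * (ρ * a ^ 3) := by
    calc (ρ * a * L ^ 2) ^ 3 = ρ ^ 3 * a ^ 3 * (L ^ 2) ^ 3 := by ring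
      _ = ρ ^ 3 * a ^ 3 * (N / ρ) ^ 2 := by rw [hL6]
      _ = N ^ 2 * (ρ * a ^ 3) := by field_simp
  have hN28 : N ^ 2 ≤ N ^ 8 := pow_le_pow_right₀ hN (by norm_num)
  have hρa : 0 ≤ ρ * a ^ 3 := by positivity
  calc (ρ * a * L ^ 2) ^ 3 = N ^ 2 * (ρ * a ^ 3) := hX3
    _ ≤ N ^ 8 * (ρ * a ^ 3) := mul_le_mul_of_nonneg_right hN28 hρa
    _ ≤ c := hwin
    _ ≤ (4 * Real.pi ^ 2) ^ 3 := hc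
    _ = ((2 * Real.pi) ^ 2) ^ 3 := by ring

/-! ## The LSSY upper bound at `L = (N/ρ)^{1/3}` -/

/-- **Dyson–LSSY upper bound along `L = (N/ρ)^{1/3}`.** For an admissible `v` there are `ρ₀ > 0` and
`K > 0` with `E₀^per(v,N,L).toReal ≤ K ρ a N` for all `0 < ρ < ρ₀` and all `N ≥ 2`
(`a = (scatteringLength v).toReal`; from `LSSY2005_upperBound_periodic_holds` with `ρ₁ ≤ ρ`,
`a/b ≤ c₁`). [cite: LSSY2005, Thm. 2.2 (2.14)] -/
theorem exists_groundStateEnergy_toReal_le {v : ℝ → ℝ≥0∞} (hv : IsRepulsiveFiniteRange v) :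
    ∃ ρ₀ : ℝ, 0 < ρ₀ ∧ ∃ K : ℝ, 0 < K ∧ ∀ ρ : ℝ, 0 < ρ → ρ < ρ₀ → ∀ N : ℕ, 2 ≤ N →
      (periodicGroundStateEnergy v N (sideLength ρ N)).toReal ≤
        K * ρ * (scatteringLength v).toReal * N := by
  obtain ⟨R₀, hR₀⟩ := hv.2
  set R : ℝ := max R₀ 1 with hRdef
  have hRpos : 0 < R := lt_of_lt_of_le one_pos (le_max_right _ _)
  have hR : ∀ r, R < r → v r = 0 := fun r hr => hR₀ r ((le_max_left _ _).trans_lt hr)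
  obtain ⟨C, c₁, hC, hc₁, hLSSY⟩ :=
    LSSY2005_upperBound_periodic_holds v R hv.1 hR hv.scatteringLength_ne_top
  set a : ℝ := (scatteringLength v).toReal with hadef
  have ha : 0 ≤ a := ENNReal.toReal_nonneg
  refine ⟨min (1 / (2 * R) ^ 3) (3 * c₁ ^ 3 / (4 * Real.pi * (a ^ 3 + 1))),
    lt_min (by positivity) (by positivity), 4 * Real.pi * (1 + C * c₁), by positivity, ?_⟩
  intro ρ hρ hρlt N hN2
  have hN0 : 0 < N := by omega
  have hL : 0 < sideLength ρ N := sideLength_pos hρ hN0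
  have hL3 : sideLength ρ N ^ 3 = N / ρ := sideLength_pow_three hρ N
  have hNR : (1 : ℝ) ≤ N := by exact_mod_cast hN0
  have hN2R : (2 : ℝ) ≤ N := by exact_mod_cast hN2
  have h2R : 2 * R < sideLength ρ N :=
    two_mul_lt_of_pow_three hRpos hρ hL hNR hL3 (hρlt.trans_le (min_le_left _ _))
  generalize sideLength ρ N = L at hL hL3 h2R ⊢
  -- the effective density `ρₑ = (N-1)/L³ ≤ ρ`
  set ρe : ℝ := ((N : ℝ) - 1) / L ^ 3 with hρe
  have hρe_le : ρe ≤ ρ := by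
    rw [hρe, hL3, div_div_eq_mul_div]
    rw [div_le_iff₀ (by positivity)]
    nlinarith
  have hρe_nonneg : 0 ≤ ρe := by rw [hρe]; exact div_nonneg (by linarith) (by positivity)
  have hab : a / (4 * Real.pi * ρe / 3) ^ (-(1 : ℝ) / 3) ≤ c₁ :=
    ratio_le_of_density_le ha hc₁ hρe_nonneg hρe_le (hρlt.le.trans (min_le_right _ _))
  have hU := hLSSY N L hN2 hL h2R
  simp only at hU
  have hU' := hU hab
  have hab0 : 0 ≤ a / (4 * Real.pi * ρe / 3) ^ (-(1 : ℝ) / 3) :=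
    div_nonneg ha (Real.rpow_nonneg (by positivity) _)
  have hbound : 4 * Real.pi * ρe * a * (1 + C * (a / (4 * Real.pi * ρe / 3) ^ (-(1 : ℝ) / 3))) * N ≤
      4 * Real.pi * (1 + C * c₁) * ρ * a * N := by
    have h1 : 1 + C * (a / (4 * Real.pi * ρe / 3) ^ (-(1 : ℝ) / 3)) ≤ 1 + C * c₁ := by
      have := mul_le_mul_of_nonneg_left hab hC.le
      linarith
    have h0 : 0 ≤ 1 + C * (a / (4 * Real.pi * ρe / 3) ^ (-(1 : ℝ) / 3)) := by positivity
    calc 4 * Real.pi * ρe * a * (1 + C * (a / (4 * Real.pi * ρe / 3) ^ (-(1 : ℝ) / 3))) * N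
        ≤ 4 * Real.pi * ρ * a * (1 + C * c₁) * N := by gcongr
      _ = 4 * Real.pi * (1 + C * c₁) * ρ * a * N := by ring
  exact ENNReal.toReal_le_of_le_ofReal (by positivity) (hU'.trans (ENNReal.ofReal_le_ofReal hbound))

/-! ## The stub -/

/-- **`FewBodyWindow`** (stub `stub_fewBodyWindow` of the seat-c2 layer of line
`stable-fraction-square-completion`): for every admissible `v` there are `ρ₀, c > 0` such that for
`0 < ρ < ρ₀`, `N ≥ 1` and `N⁸·ρa³ ≤ c` the system at `L = (N/ρ)^{1/3}` is in the few-body regime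
`N·E₀^per(v,N,L)·L² ≤ 4π²/5` (LSSY periodic upper bound `E₀ ≤ KρaN` for `N ≥ 2`, `E₀ = 0` for `N = 1`)
and on the ultraviolet branch `ρa ≤ |p|²` for every `k ≠ 0`. [cite: LSSY2005, Thm. 2.2 (2.14)] -/
theorem stub_fewBodyWindow :
    ∀ v : ℝ → ℝ≥0∞, IsRepulsiveFiniteRange v →
      ∃ ρ₀ : ℝ, 0 < ρ₀ ∧ ∃ c : ℝ, 0 < c ∧
        ∀ ρ : ℝ, 0 < ρ → ρ < ρ₀ → ∀ N : ℕ, 1 ≤ N →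
          (N : ℝ) ^ 8 * (ρ * (scatteringLength v).toReal ^ 3) ≤ c →
          (N : ℝ) * (periodicGroundStateEnergy v N (sideLength ρ N)).toReal * sideLength ρ N ^ 2
              ≤ 4 * Real.pi ^ 2 / 5 ∧
          ∀ k : Fin 3 → ℤ, k ≠ 0 → ρ * (scatteringLength v).toReal ≤ psq (sideLength ρ N) k := by
  intro v hv
  obtain ⟨ρ₀, hρ₀, K, hK, hE⟩ := exists_groundStateEnergy_toReal_le hv
  have ha : 0 ≤ (scatteringLength v).toReal := ENNReal.toReal_nonneg
  refine ⟨ρ₀, hρ₀, min ((4 * Real.pi ^ 2 / (5 * K)) ^ 3) ((4 * Real.pi ^ 2) ^ 3),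
    lt_min (by positivity) (by positivity), ?_⟩
  intro ρ hρ hρlt N hN hwin
  have hN0 : 0 < N := hN
  have hL : 0 < sideLength ρ N := sideLength_pos hρ hN0
  have hL3 : sideLength ρ N ^ 3 = N / ρ := sideLength_pow_three hρ N
  have hNR : (1 : ℝ) ≤ N := by exact_mod_cast hN
  refine ⟨?_, fun k hk => ?_⟩
  · rcases Nat.lt_or_ge N 2 with h1 | h2
    · obtain rfl : N = 1 := by omega
      rw [periodicGroundStateEnergy_one hL v, ENNReal.toReal_zero, mul_zero, zero_mul]
      positivity
    · calc (N : ℝ) * (periodicGroundStateEnergy v N (sideLength ρ N)).toReal * sideLength ρ N ^ 2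
          ≤ N * (K * ρ * (scatteringLength v).toReal * N) * sideLength ρ N ^ 2 := by
            gcongr
            exact hE ρ hρ hρlt N h2
        _ ≤ 4 * Real.pi ^ 2 / 5 :=
            energy_window_le hK hρ hL3 hwin (min_le_left _ _)
  · exact (density_mul_le_sq_div hρ ha hNR hL hL3 hwin (min_le_right _ _)).trans
      (sq_div_le_psq _ hk)

end Summit.AtomisticToContinuum.BoseEinsteinCondensation.Cruxes.StaticResponseBound.FewBody

end
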